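import Mathlib
import HarnessLib
import Literature.Probability.MarkovChains.BottleneckRatio
import Literature.Probability.MarkovChains.ErgodicityCoefficient

/-!
# `d(t) ≤ d̄(t) ≤ 2d(t)`, submultiplicativity `d̄(s+t) ≤ d̄(s)d̄(t)`, and `t_mix(ε) ≤ ⌈log₂ ε⁻¹⌉ t_mix` (Levin–Peres–Wilmer §4.4–4.5)

HONEST FRAMING: exact (Metropolis-corrected) sampling algorithms for lattice gauge theory; figures
of merit are autocorrelation/cost numbers at stated couplings and volumes; no continuum-physics claim.

Conventions of `TotalVariation.lean` / `BottleneckRatio.lean` (finite `X`, ROW kernel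
`P : X → X → ℝ`, `lawAt P μ t = μPᵗ`, `worstTvDist P π t = d(t)`, `mixingTime P π ε = t_mix(ε)`).
Source: D. A. Levin, Y. Peres (with E. L. Wilmer), *Markov Chains and Mixing Times*, 2nd ed.,
AMS 2017 [LevinPeres2017], §4.4 (Lemma 4.10, Lemma 4.11, eq. (4.29), Exercise 4.3) and §4.5
(eqs. (4.32)–(4.34)).  Everything is PROVED (finite sums; 0 named facts).

* `kernelAt P t` — the `t`-step kernel `Pᵗ(x,y)` (so that `μPᵗ = stepLaw (kernelAt P t) μ`,
  `lawAt_eq_stepLaw_kernelAt`, and `μP^{s+t} = (μPˢ)Pᵗ`, `lawAt_add`) [cite: LevinPeres2017, §1.1];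
* `worstPairTvDist P t = d̄(t) = max_{x,y} ‖Pᵗ(x,·) − Pᵗ(y,·)‖_TV` [cite: LevinPeres2017, §4.4
  eq. (4.23)]; `worstPairTvDist_eq_ergodicCoeff` — `d̄(t)` IS Seneta's / Dobrushin's ergodicity
  coefficient `τ(Pᵗ)` of `ErgodicityCoefficient.lean` (same formula);
* **LEMMA 4.10** `worstTvDist_le_worstPairTvDist` / `worstPairTvDist_le_two_mul` :
  `d(t) ≤ d̄(t) ≤ 2d(t)` [cite: LevinPeres2017, §4.4 Lemma 4.10 eq. (4.24)];
* **LEMMA 4.11** `worstPairTvDist_add_le` : `d̄(s+t) ≤ d̄(s)d̄(t)` [cite: LevinPeres2017, §4.4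
  Lemma 4.11]; `worstTvDist_add_le` : `d(t+s) ≤ d(t)d̄(s)` [cite: LevinPeres2017, Exercise 4.3];
  `worstPairTvDist_mul_le_pow` / `worstTvDist_mul_le_pow` : `d(ct) ≤ d̄(ct) ≤ d̄(t)ᶜ` [eq. (4.29)];
* **§4.5** `worstTvDist_mul_mixingTime_le` : `d(ℓ·t_mix(ε)) ≤ (2ε)^ℓ` [eq. (4.32)],
  `worstTvDist_mul_tmix_le` : `d(ℓ·t_mix) ≤ 2^{−ℓ}` [eq. (4.33)], and
  `LevinPeres2017_eq_4_34` : `t_mix(ε) ≤ ⌈log₂ ε⁻¹⌉ · t_mix` for `0 < ε` [eq. (4.34)].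

Proof route (deviation from the printed one, recorded): the book proves Lemma 4.11 with the
optimal coupling of `Pˢ(x,·)`, `Pˢ(y,·)` (Prop. 4.7, eqs. (4.26)–(4.28)); here the same inequality
is DOBRUSHIN'S CONTRACTION `‖μPᵗ − νPᵗ‖_TV ≤ τ(Pᵗ)‖μ − ν‖_TV` (`ErgodicityCoefficient.
tvDist_stepLaw_le_mul`, Kirkland–Neumann Lemma 5.3.4 / Seneta) applied to the `t`-step kernel,
with `τ(Pᵗ) = d̄(t)` — the analytic form of the coupling argument (Aldous 1983, Lemma 3.5, is
cited by the book's Notes to Ch. 4 as a version of Lemma 4.11).  Hypotheses: `P` row-stochastic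
throughout; `πP = π` with `π` a probability vector where `d(t)` is compared (Lemma 4.10, (4.29) for
`d`, §4.5); the §4.5 statements assume that SOME time is `1/4`- (resp. `ε`-) close, since
`mixingTime` carries the junk value `0` otherwise (every irreducible aperiodic chain qualifies —
the Convergence Theorem 4.9, not formalised here).  Not here: Prop. 4.7 (coupling
characterisation of total variation), Theorem 4.9, the `ℓᵖ` distances of §4.7.
-/

namespace Literature.Probability.MarkovChains

open Finset Matrix

variable {X : Type*} [Fintype X] [DecidableEq X]

/-! ## The `t`-step kernel -/

/-- The `t`-step kernel `Pᵗ(x,y) = (δ_x Pᵗ)(y)`. [cite: LevinPeres2017, §1.1 (`Pᵗ(x,y)`, the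
`t`-step transition probabilities)] -/
def kernelAt (P : X → X → ℝ) (t : ℕ) : X → X → ℝ := fun x y => lawAt P (Pi.single x 1) t y

/-- `μPᵗ = μ · (Pᵗ)`: the law at time `t` is one step of the `t`-step kernel.
[cite: LevinPeres2017, §1.1 (`μ_t = μ_0 Pᵗ`)] -/
theorem lawAt_eq_stepLaw_kernelAt (P : X → X → ℝ) (μ : X → ℝ) (t : ℕ) :
    lawAt P μ t = stepLaw (kernelAt P t) μ := by
  funext y
  rw [lawAt_eq_sum_mul_lawAt_single]
  rfl

omit [DecidableEq X] in
/-- `μP^{s+t} = (μPˢ)Pᵗ`. [cite: LevinPeres2017, §1.1 (`μ_t = μ_{t-1}P`, iterated)] -/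
theorem lawAt_add (P : X → X → ℝ) (μ : X → ℝ) (s t : ℕ) :
    lawAt P μ (s + t) = lawAt P (lawAt P μ s) t := by
  unfold lawAt
  rw [add_comm, Function.iterate_add_apply]

/-- `Pᵗ(x,·)` is a probability vector: total mass one (row-stochastic `P`).
[cite: LevinPeres2017, §1.1 (`Pᵗ` is stochastic)] -/
theorem sum_kernelAt {P : X → X → ℝ} (hP : IsRowStochastic P) (t : ℕ) (x : X) :
    ∑ y, kernelAt P t x y = 1 := by
  show ∑ y, lawAt P (Pi.single x 1) t y = 1
  rw [sum_lawAt hP, Finset.sum_pi_single']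
  simp

/-- `Pᵗ` is row-stochastic when `P` is. [cite: LevinPeres2017, §1.1 (`Pᵗ` is stochastic)] -/
theorem kernelAt_isRowStochastic {P : X → X → ℝ} (hP : IsRowStochastic P) (t : ℕ) :
    IsRowStochastic (kernelAt P t) :=
  ⟨fun x y => lawAt_nonneg hP (fun z => by
    rw [Pi.single_apply]; split_ifs <;> norm_num) t y, sum_kernelAt hP t⟩

/-- A stationary `π` is fixed by the `t`-step kernel: `πPᵗ = π`, i.e.
`stepLaw (kernelAt P t) π = π`. [cite: LevinPeres2017, §1.5 eq. (1.22) (`π = πP`, iterated)] -/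
theorem stepLaw_kernelAt_eq_self_of_isStationary {P : X → X → ℝ} {π : X → ℝ}
    (hπ : IsStationary π P) (t : ℕ) : stepLaw (kernelAt P t) π = π := by
  rw [← lawAt_eq_stepLaw_kernelAt, lawAt_eq_self_of_isStationary hπ]

/-! ## `d̄(t)` and Lemma 4.10 -/

/-- `d̄(t) = max_{x,y ∈ X} ‖Pᵗ(x,·) − Pᵗ(y,·)‖_TV` (as `⨆` over pairs; `0` on an empty `X`).
[cite: LevinPeres2017, §4.4 eq. (4.23)] -/
noncomputable def worstPairTvDist (P : X → X → ℝ) (t : ℕ) : ℝ :=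
  ⨆ p : X × X, tvDist (lawAt P (Pi.single p.1 1) t) (lawAt P (Pi.single p.2 1) t)

/-- `d̄(t) ≥ 0`. [cite: LevinPeres2017, §4.4 eq. (4.23)] -/
theorem worstPairTvDist_nonneg (P : X → X → ℝ) (t : ℕ) : 0 ≤ worstPairTvDist P t :=
  Real.iSup_nonneg fun _ => tvDist_nonneg _ _

/-- `‖Pᵗ(x,·) − Pᵗ(y,·)‖_TV ≤ d̄(t)` for every pair of starting states.
[cite: LevinPeres2017, §4.4 eq. (4.23)] -/
theorem tvDist_pair_le_worstPairTvDist (P : X → X → ℝ) (t : ℕ) (x y : X) :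
    tvDist (lawAt P (Pi.single x 1) t) (lawAt P (Pi.single y 1) t) ≤ worstPairTvDist P t :=
  le_ciSup (f := fun p : X × X => tvDist (lawAt P (Pi.single p.1 1) t) (lawAt P (Pi.single p.2 1) t))
    (Set.finite_range _).bddAbove (x, y)

/-- `d̄(t)` is Seneta's ergodicity coefficient `τ(Pᵗ)` of the `t`-step kernel (the two printed
formulas coincide: `½ max_{x,y} Σ_z |Pᵗ(x,z) − Pᵗ(y,z)|`). [cite: LevinPeres2017, §4.4 eq. (4.23)];
[cite: KirklandNeumann2012, §5.3 eq. (5.14)] -/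
theorem worstPairTvDist_eq_ergodicCoeff (P : X → X → ℝ) (t : ℕ) :
    worstPairTvDist P t = ergodicCoeff (kernelAt P t) := by
  unfold worstPairTvDist ergodicCoeff tvDist kernelAt
  rw [Real.mul_iSup_of_nonneg (by norm_num : (0 : ℝ) ≤ 1 / 2)]

/-- **Lemma 4.10, first inequality: `d(t) ≤ d̄(t)`** (for `πP = π`, `π` a probability vector):
`‖Pᵗ(x,·) − π‖_TV = ‖Pᵗ(x,·) − Σ_y π(y)Pᵗ(y,·)‖_TV ≤ Σ_y π(y)‖Pᵗ(x,·) − Pᵗ(y,·)‖_TV ≤ d̄(t)`.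
[cite: LevinPeres2017, §4.4 Lemma 4.10 eq. (4.24)–(4.25)] -/
theorem worstTvDist_le_worstPairTvDist {P : X → X → ℝ} {π : X → ℝ} (hπ : IsStationary π P)
    (hπ0 : ∀ x, 0 ≤ π x) (hπ1 : ∑ x, π x = 1) (t : ℕ) :
    worstTvDist P π t ≤ worstPairTvDist P t := by
  refine Real.iSup_le (fun x => ?_) (worstPairTvDist_nonneg P t)
  set L : X → X → ℝ := fun z => lawAt P (Pi.single z 1) t with hL
  -- `π = πPᵗ = Σ_y π(y) Pᵗ(y,·)`
  have hπt : ∀ z, π z = ∑ y, π y * L y z := fun z => by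
    have h := lawAt_eq_sum_mul_lawAt_single P π t z
    rwa [lawAt_eq_self_of_isStationary hπ] at h
  have hpt : ∀ z, |L x z - π z| ≤ ∑ y, π y * |L x z - L y z| := by
    intro z
    have h1 : L x z - π z = ∑ y, π y * (L x z - L y z) := by
      rw [hπt z]
      simp only [mul_sub, sum_sub_distrib, ← sum_mul, hπ1, one_mul]
    rw [h1]
    refine (abs_sum_le_sum_abs _ _).trans (le_of_eq (sum_congr rfl fun y _ => ?_))
    rw [abs_mul, abs_of_nonneg (hπ0 y)]
  calc tvDist (lawAt P (Pi.single x 1) t) π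
      = (1 / 2) * ∑ z, |L x z - π z| := rfl
    _ ≤ (1 / 2) * ∑ z, ∑ y, π y * |L x z - L y z| :=
        mul_le_mul_of_nonneg_left (sum_le_sum fun z _ => hpt z) (by norm_num)
    _ = ∑ y, π y * tvDist (L x) (L y) := by
        rw [sum_comm, mul_sum]
        refine sum_congr rfl fun y _ => ?_
        unfold tvDist
        rw [mul_sum, mul_sum, mul_sum]
        exact sum_congr rfl fun z _ => by ring
    _ ≤ ∑ y, π y * worstPairTvDist P t :=
        sum_le_sum fun y _ =>
          mul_le_mul_of_nonneg_left (tvDist_pair_le_worstPairTvDist P t x y) (hπ0 y)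
    _ = worstPairTvDist P t := by rw [← sum_mul, hπ1, one_mul]

/-- **Lemma 4.10, second inequality: `d̄(t) ≤ 2d(t)`** (triangle inequality through `π`).
[cite: LevinPeres2017, §4.4 Lemma 4.10 eq. (4.24)] -/
theorem worstPairTvDist_le_two_mul (P : X → X → ℝ) (π : X → ℝ) (t : ℕ) :
    worstPairTvDist P t ≤ 2 * worstTvDist P π t := by
  refine Real.iSup_le (fun p => ?_) (by linarith [worstTvDist_nonneg P π t])
  calc tvDist (lawAt P (Pi.single p.1 1) t) (lawAt P (Pi.single p.2 1) t)
      ≤ tvDist (lawAt P (Pi.single p.1 1) t) π + tvDist π (lawAt P (Pi.single p.2 1) t) :=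
        tvDist_triangle _ _ _
    _ ≤ worstTvDist P π t + worstTvDist P π t := by
        rw [tvDist_comm π]
        exact add_le_add (tvDist_single_le_worstTvDist P π t p.1)
          (tvDist_single_le_worstTvDist P π t p.2)
    _ = 2 * worstTvDist P π t := by ring

/-! ## Lemma 4.11 (submultiplicativity) and eq. (4.29) -/

/-- Contraction by the `t`-step kernel: `‖μP^{s+t} − νP^{s+t}‖_TV ≤ d̄(t)·‖μPˢ − νPˢ‖_TV` for laws
of equal mass — Dobrushin's contraction for `Pᵗ` with `τ(Pᵗ) = d̄(t)` (the analytic form of the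
coupling step (4.27)–(4.28)). [cite: LevinPeres2017, §4.4 Lemma 4.11 (proof, eqs. (4.27)–(4.28))];
[cite: KirklandNeumann2012, §5.3 Remark 5.3.7] -/
theorem tvDist_lawAt_add_le_mul (P : X → X → ℝ) {μ ν : X → ℝ} (h : ∑ x, μ x = ∑ x, ν x)
    (s t : ℕ) (hP : IsRowStochastic P) :
    tvDist (lawAt P μ (s + t)) (lawAt P ν (s + t)) ≤
      worstPairTvDist P t * tvDist (lawAt P μ s) (lawAt P ν s) := by
  rw [lawAt_add, lawAt_add, lawAt_eq_stepLaw_kernelAt P (lawAt P μ s),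
    lawAt_eq_stepLaw_kernelAt P (lawAt P ν s), worstPairTvDist_eq_ergodicCoeff]
  exact tvDist_stepLaw_le_mul (by rw [sum_lawAt hP, sum_lawAt hP, h]) _

/-- **Lemma 4.11: `d̄` is submultiplicative, `d̄(s+t) ≤ d̄(s)·d̄(t)`** (row-stochastic `P`).
[cite: LevinPeres2017, §4.4 Lemma 4.11] -/
theorem worstPairTvDist_add_le {P : X → X → ℝ} (hP : IsRowStochastic P) (s t : ℕ) :
    worstPairTvDist P (s + t) ≤ worstPairTvDist P s * worstPairTvDist P t := by
  refine Real.iSup_le (fun p => ?_)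
    (mul_nonneg (worstPairTvDist_nonneg P s) (worstPairTvDist_nonneg P t))
  have hmass : ∑ z, (Pi.single p.1 (1 : ℝ) : X → ℝ) z = ∑ z, (Pi.single p.2 (1 : ℝ) : X → ℝ) z := by
    rw [Finset.sum_pi_single', Finset.sum_pi_single']; simp
  calc tvDist (lawAt P (Pi.single p.1 1) (s + t)) (lawAt P (Pi.single p.2 1) (s + t))
      ≤ worstPairTvDist P t * tvDist (lawAt P (Pi.single p.1 1) s) (lawAt P (Pi.single p.2 1) s) :=
        tvDist_lawAt_add_le_mul P hmass s t hP
    _ ≤ worstPairTvDist P t * worstPairTvDist P s :=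
        mul_le_mul_of_nonneg_left (tvDist_pair_le_worstPairTvDist P s p.1 p.2)
          (worstPairTvDist_nonneg P t)
    _ = worstPairTvDist P s * worstPairTvDist P t := mul_comm _ _

/-- **Exercise 4.3: `d(t+s) ≤ d(t)·d̄(s)`** (row-stochastic `P`, `πP = π`).
[cite: LevinPeres2017, Exercise 4.3] -/
theorem worstTvDist_add_le {P : X → X → ℝ} (hP : IsRowStochastic P) {π : X → ℝ}
    (hπ : IsStationary π P) (hπ1 : ∑ x, π x = 1) (t s : ℕ) :
    worstTvDist P π (t + s) ≤ worstTvDist P π t * worstPairTvDist P s := by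
  refine Real.iSup_le (fun x => ?_)
    (mul_nonneg (worstTvDist_nonneg P π t) (worstPairTvDist_nonneg P s))
  have hmass : ∑ z, lawAt P (Pi.single x 1) t z = ∑ z, π z := by
    rw [sum_lawAt hP, Finset.sum_pi_single']; simp [hπ1]
  calc tvDist (lawAt P (Pi.single x 1) (t + s)) π
      = tvDist (stepLaw (kernelAt P s) (lawAt P (Pi.single x 1) t)) (stepLaw (kernelAt P s) π) := by
        rw [lawAt_add, lawAt_eq_stepLaw_kernelAt P (lawAt P _ t),
          stepLaw_kernelAt_eq_self_of_isStationary hπ]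
    _ ≤ ergodicCoeff (kernelAt P s) * tvDist (lawAt P (Pi.single x 1) t) π :=
        tvDist_stepLaw_le_mul hmass _
    _ ≤ worstPairTvDist P s * worstTvDist P π t := by
        rw [← worstPairTvDist_eq_ergodicCoeff]
        exact mul_le_mul_of_nonneg_left (tvDist_single_le_worstTvDist P π t x)
          (worstPairTvDist_nonneg P s)
    _ = worstTvDist P π t * worstPairTvDist P s := mul_comm _ _

/-- `d̄(0) ≤ 1` (two point masses are at total variation distance `≤ 1`).
[cite: LevinPeres2017, §4.4 (total variation distance is at most `1`)] -/
theorem worstPairTvDist_zero_le_one (P : X → X → ℝ) : worstPairTvDist P 0 ≤ 1 := by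
  refine Real.iSup_le (fun p => ?_) zero_le_one
  rw [lawAt_zero, lawAt_zero]
  refine tvDist_le_one (fun z => ?_) (fun z => ?_) ?_ ?_
  · rw [Pi.single_apply]; split_ifs <;> norm_num
  · rw [Pi.single_apply]; split_ifs <;> norm_num
  · rw [Finset.sum_pi_single']; simp
  · rw [Finset.sum_pi_single']; simp

/-- **Eq. (4.29), for `d̄`: `d̄(ct) ≤ d̄(t)ᶜ`** (row-stochastic `P`; all `c, t : ℕ`).
[cite: LevinPeres2017, §4.4 eq. (4.29)] -/
theorem worstPairTvDist_mul_le_pow {P : X → X → ℝ} (hP : IsRowStochastic P) (c t : ℕ) :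
    worstPairTvDist P (c * t) ≤ worstPairTvDist P t ^ c := by
  induction c with
  | zero => rw [zero_mul, pow_zero]; exact worstPairTvDist_zero_le_one P
  | succ c ih =>
    rw [add_mul, one_mul, pow_succ]
    exact (worstPairTvDist_add_le hP _ _).trans
      (mul_le_mul_of_nonneg_right ih (worstPairTvDist_nonneg P t))

/-- **Eq. (4.29): `d(ct) ≤ d̄(ct) ≤ d̄(t)ᶜ`** (row-stochastic `P`, `πP = π`, `π` a probability
vector). [cite: LevinPeres2017, §4.4 eq. (4.29)] -/
theorem worstTvDist_mul_le_pow {P : X → X → ℝ} (hP : IsRowStochastic P) {π : X → ℝ}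
    (hπ : IsStationary π P) (hπ0 : ∀ x, 0 ≤ π x) (hπ1 : ∑ x, π x = 1) (c t : ℕ) :
    worstTvDist P π (c * t) ≤ worstPairTvDist P t ^ c :=
  (worstTvDist_le_worstPairTvDist hπ hπ0 hπ1 _).trans (worstPairTvDist_mul_le_pow hP c t)

/-! ## §4.5: `d(ℓ t_mix(ε)) ≤ (2ε)^ℓ` and `t_mix(ε) ≤ ⌈log₂ ε⁻¹⌉ t_mix` -/

/-- **Eq. (4.32): `d(ℓ·t_mix(ε)) ≤ d̄(t_mix(ε))^ℓ ≤ (2ε)^ℓ`**, for a chain that is `ε`-close at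
some time. [cite: LevinPeres2017, §4.5 eq. (4.32)] -/
theorem worstTvDist_mul_mixingTime_le {P : X → X → ℝ} (hP : IsRowStochastic P) {π : X → ℝ}
    (hπ : IsStationary π P) (hπ0 : ∀ x, 0 ≤ π x) (hπ1 : ∑ x, π x = 1) {ε : ℝ} {t₀ : ℕ}
    (h : worstTvDist P π t₀ ≤ ε) (ℓ : ℕ) :
    worstTvDist P π (ℓ * mixingTime P π ε) ≤ (2 * ε) ^ ℓ := by
  have h1 := worstTvDist_mul_le_pow hP hπ hπ0 hπ1 ℓ (mixingTime P π ε)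
  have h2 : worstPairTvDist P (mixingTime P π ε) ≤ 2 * ε :=
    (worstPairTvDist_le_two_mul P π _).trans
      (mul_le_mul_of_nonneg_left (worstTvDist_mixingTime_le P π h) (by norm_num))
  exact h1.trans (pow_le_pow_left₀ (worstPairTvDist_nonneg P _) h2 ℓ)

/-- **Eq. (4.33): `d(ℓ·t_mix) ≤ 2^{−ℓ}`** (`t_mix = t_mix(1/4)`), for a chain that is `1/4`-close at
some time. [cite: LevinPeres2017, §4.5 eq. (4.33)] -/
theorem worstTvDist_mul_tmix_le {P : X → X → ℝ} (hP : IsRowStochastic P) {π : X → ℝ}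
    (hπ : IsStationary π P) (hπ0 : ∀ x, 0 ≤ π x) (hπ1 : ∑ x, π x = 1) {t₀ : ℕ}
    (h : worstTvDist P π t₀ ≤ 1 / 4) (ℓ : ℕ) :
    worstTvDist P π (ℓ * mixingTime P π (1 / 4)) ≤ (2 : ℝ)⁻¹ ^ ℓ := by
  have := worstTvDist_mul_mixingTime_le hP hπ hπ0 hπ1 h ℓ
  norm_num at this ⊢
  exact this

/-- **Eq. (4.34): `t_mix(ε) ≤ ⌈log₂ ε⁻¹⌉ · t_mix`** for every `ε > 0`, for a chain that is
`1/4`-close at some time (`⌈·⌉` = `Nat.ceil`; for `ε ≥ 1` the factor is `0` and indeed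
`t_mix(ε) = 0`). [cite: LevinPeres2017, §4.5 eq. (4.34)] -/
theorem LevinPeres2017_eq_4_34 {P : X → X → ℝ} (hP : IsRowStochastic P) {π : X → ℝ}
    (hπ : IsStationary π P) (hπ0 : ∀ x, 0 ≤ π x) (hπ1 : ∑ x, π x = 1) {t₀ : ℕ}
    (h : worstTvDist P π t₀ ≤ 1 / 4) {ε : ℝ} (hε : 0 < ε) :
    mixingTime P π ε ≤ ⌈Real.logb 2 ε⁻¹⌉₊ * mixingTime P π (1 / 4) := by
  set ℓ : ℕ := ⌈Real.logb 2 ε⁻¹⌉₊ with hℓ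
  refine mixingTime_le P π ((worstTvDist_mul_tmix_le hP hπ hπ0 hπ1 h ℓ).trans ?_)
  -- `2^{-ℓ} ≤ ε` since `ℓ ≥ log₂ ε⁻¹`
  have hℓge : Real.logb 2 ε⁻¹ ≤ (ℓ : ℝ) := Nat.le_ceil _
  have h2 : (0 : ℝ) < 2 := by norm_num
  have key : ε⁻¹ ≤ (2 : ℝ) ^ (ℓ : ℝ) := by
    have := Real.rpow_le_rpow_of_exponent_le (by norm_num : (1 : ℝ) ≤ 2) hℓge
    rwa [Real.rpow_logb h2 (by norm_num) (inv_pos.mpr hε)] at this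
  rw [Real.rpow_natCast] at key
  rw [inv_pow]
  calc ((2 : ℝ) ^ ℓ)⁻¹ ≤ (ε⁻¹)⁻¹ := inv_anti₀ (inv_pos.mpr hε) key
    _ = ε := inv_inv ε

end Literature.Probability.MarkovChains
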